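import Summits.QuantumFields.YangMills.Theorems.BalabanUVNodesN16EntrySqueezeJunctionReadingFree
import Summits.QuantumFields.YangMills.Theorems.BalabanUVNodesN14SourceTowerOfRecordAx
import Summits.QuantumFields.YangMills.Theorems.BalabanUVNodesN15PairedFamilyGuardAx

/-!
# Route «BalabanUVNodes», crux K3ᴬ `SpineGivenEndpointR13SepCoPHVAx` (stmt-QuantumFields-27247), node N16 = NE3 — THE TUNED-WITNESS FACE AT THE CENTRE-MAP-GENERIC ∕ Ax
# READING: node N16's STUB-1 SHARE of the registered K3ᴬ v8 skeleton (`K3Skeleton13SepCoPHAxV8` b38fad1764a2d455, plan g100, 2026-08-31T04:29Z) — the three N16 guard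
# conjuncts `N16PinnedLooseAx 𝔯 ℓ₃ B ∧ N16LettersEnd 2 g ℓ₃ ∧ N16RadiusMatch ℓ₃ B` of `GuardedReadingN16` (:387) AND N16's conjunct `N16HolderAt (rrOfRecord 𝔯 ksel …).ne3 β` of
# the rates row `PHolderD4` (:326), JOINTLY, relative to ANY guard that does not read the NE3 layer — from the reading-free tuned-witness sentence, i.e. from node N16's
# chain-entry object `hE` (or node N05's Σ-object `hN05`) and node N07's Reg910 slot key (module 62)

Cell `pub-ymgap`, seat `pub-ymgap-dag-n16-e` (R134 acceleration seat (a), strategy s2 = BY-NAME KNIT at the record; HUMAN RULING D-0062; chair R424 venue), generation 31,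
module 63 (2 `def` — a Prop-valued SENTENCE and a READING RE-PIN, no content — + kernel bookkeeping; 0 `sorry`, standard axioms; Theses-free, importable).
`--supports stmt-QuantumFields-27247 --as helper` (count-neutral; proves NO registered stub).  `bears_on: R4∕N16 · edges N05 → N16, N07 → N16`.
The Ax edition of modules 60 §2∕§4 (`…N16DialScalingCertificate` ✓p776216: `repin`, `WitnessDialN16`) and 61 (`…N16WitnessDialFace` ✓p776555) — K3⁸'s CoPH-tower faces —
over T1-core `RateReading₁₃CoPHCmap N Χ` (✓p805119), R12 `N16PinnedLooseCmap ∕ N16HolderAtReadingCmap` (✓p805490) and module 62's READING-FREE producer.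

WHY (this seat's LOCATED «N16's K3 share is CENTRE-BLIND», pub-ymgap INBOX l.21677, shape (5c-ii)).  The K3ᴬ v8 stub 1 binds `∃ 𝔯 ksel ℓ ℓ₃ g B, GuardedReadingN16 𝔯 ksel ℓ ℓ₃ g B ∧
KeyedRatesHolderD4V β (rrOfRecord 𝔯 ksel)` over the Ax tower.  Node N16 owns, of this: the pin `N16PinnedLooseAx 𝔯 ℓ₃ B`, THE END's letter rows `N16LettersEnd 2 g ℓ₃`, the radius
MATCH row `N16RadiusMatch ℓ₃ B := ∀ F, 0 < B F ∧ (ℓ₃ F).ε ∕ B F ≤ (ℓ₃ F).b` (:381), and the conjunct `N16HolderAt R.ne3 β` of `RatesHolderAt D R β` inside `PHolderD4 β D R` at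
`R := rrOfRecord 𝔯 ksel F θ hP g₀ os = rateCarriersOfRecord₁₃CoPHCmap 𝔯 F θ hP g₀ os (ksel …)`.  §3's ★ theorem delivers ALL FOUR at once, for the re-pinned reading
`repinCmap 𝔯 ℓ₃ B` of ANY reading `𝔯` the closer already holds, under ANY guard `G` closed under `repinCmap` — the skeleton's `fun 𝔯 => GuardedReading 𝔯 ksel ℓ` (:375:
`Ne1PinnedOfRecordAx 𝔯 ∧ KeyedLiveAx (rrOfRecord 𝔯 ksel) ∧ N15PinnedSized 𝔯 ∧ U3PinnedKernels 𝔯 ℓ`) is such a guard by `fun _ _ _ h => h`, since its four conjuncts read the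
reading only through `𝔯.ne1`, `(𝔯.lit …).ne2`, `(𝔯.lit …).u3`, all untouched by `repinCmap` (§2's `rfl` faces; §4 checks the two conjuncts that are TREE predicates —
R9 `Ne1PinnedOfRecordCmap`, R11 `KeyedLiveCmap` — by exactly that term).

CONTENTS.  §1 `WitnessDialN16Free N β` — the tuned-witness (∃-dial) sentence of module 60 §4 made READING- and CENTRE-FREE: SOME admissible dial `(ℓ₃, g, B)` (THE END's rows
+ the MATCH row) such that N16's conjunct holds AT RR-1's { ne3ConstLayerOfRecord₁₁ F N (ℓ₃ F) with
        dom := {V | V ∈ ne3DomOfRecord₁₁ F N 0 0 ∧ V ∈ sfClass 4 F.L (ne3NperOfRecord₁₁ F 0 0) ((ℓ₃ F).ε / B F) 0} } OBJECT OF RECORD for every family; producers `witnessDialN16Free_of_entry_reg910Slot` (hE + slot key, `β ≤ 1`)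
∕ `witnessDialN16Free_of_n05UniformP_reg910Slot` (hN05 + slot key, `0 ≤ β ≤ 1`) = module 62 BY NAME.  §2 `repinCmap 𝔯 ℓ₃ B` (+ `repinAx`): the reading `𝔯` with its NE3
layer RE-PINNED { ne3ConstLayerOfRecord₁₁ F N (ℓ₃ F) with
        dom := {V | V ∈ ne3DomOfRecord₁₁ F N 0 0 ∧ V ∈ sfClass 4 F.L (ne3NperOfRecord₁₁ F 0 0) ((ℓ₃ F).ε / B F) 0} } at the dial (module 60's `repin` over the centre-map-generic tower) and its `rfl` faces.  §3 ★ `exists_guarded_pin_n16HolderAt_rateCarriersCmap_of_witnessFree`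
(guard-generic, every `Χ`) · `…Ax…` (the re-centred instance, binder `θ.Provisos₁₃CoPHAx F N`) · end-to-end forms from the displayed in-edges.  §4 the two tree guard conjuncts
transfer by `h ↦ h`.

HONEST FRAMING.  Composition BY NAME (`obtain`s and anonymous constructors); no estimate.  `hE` ∕ `hN05` (node N05's [Balaban1985RegularSpaces] Thm 4 ∕ Prop 3 bodies — N05∕N06
content) and the slot key (node N07 — [Balaban1985Variational] Thm 1 (9)–(10)) are DISPLAYED hypotheses asserted for no family; no stub of K3ᴬ v8 closed or claimed (the
closer still owes `𝔯`, `ksel`, `ℓ`, the v8 guard at `𝔯`, and the other lanes' conjuncts of `KeyedRatesHolderD4V`); N16 ∕ N05 ∕ N06 ∕ N07 NOT discharged; counts UNMOVED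
(typed 28∕28 · discharged 8∕27 · A 8∕28).  One finite four-torus at fixed `ε`, Bałaban AS PRINTED — NOT ℝ⁴, NOT infinite volume, NOT OS, NOT a mass gap; the YM mass gap
(Clay) is NOT proved by any of this.  No `sorry` ∕ `instance` ∕ `notation`; standard axioms.
References: [Balaban1985RegularSpaces] T. Bałaban, CMP **99** (1985) 75–102, Thm 4 p. 88, Prop. 3 p. 87; [Balaban1985Variational] T. Bałaban, CMP **102** (1985) 277–309, Thm 1 p. 279.
-/

set_option autoImplicit false

open scoped BigOperators Matrix Matrix.Norms.L2Operator
open NormedSpace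

namespace Summit.QuantumFields.YangMills.BalabanUVNodes.N16WitnessDialFaceCmap

open Literature.MathematicalPhysics.QuantumFieldTheory.Balaban1983to89
open Literature.MathematicalPhysics.QuantumFieldTheory.Balaban1983to89.T4Continuum (T4Family ULoop)
open B7Prop1Explicit B7Prop2Explicit MatrixLog UnitaryModel
open T4AveragingDeficitWall hiding Site Plane Plaq Bond
open B7Eq92Concrete (mgauge)
open B8Ineq132 (covDerivFwd)
open B8Eq184Proof (cfgExp)
open B8Eq119TwistedAxial (Restr129)
open B8Eq138LandauZd (covLap IsLandau138)
open B8Thm4TorusAt (torusLam Thm4TorusAt)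
open B8LeafModelZdHP2Per (zdGF3HP₂Per)
open Node00 (Stage13Params Stage13HParams ChiSlot chiβOfRecord₁₃Ax IdxB8SubDPerκ NE3Objects₁₁ NE3Letters₁₁ ne3ConstLayerOfRecord₁₁ ne3NperOfRecord₁₁ ne3DomOfRecord₁₁
  one_le_ne3NperOfRecord₁₁ MatA)
open Summit.QuantumFields.BalabanUV.T4Continuum
open MinimalActionSandwich (IsMinimiser admissible)
open MinimalActionRate (sfClass)
open MinimalActionRefine (gradConst)
open MinimalActionDictionary (torusVP RadiiMono)
open AveragingDeficitLatticeH2Prep (fd)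
open B11 (Regularity)
open YMDAG.UVSplit (RateCarriers ne3OfRecord₁₁ RateReading₁₃CoPHCmap RateReading₁₃CoPHAx rateCarriersOfRecord₁₃CoPHCmap)
open Summit.QuantumFields.YangMills.BalabanUVNodes.N16HolderDefs (N16HolderAt)
open Summit.QuantumFields.YangMills.BalabanUVNodes.N16PinnedLayer13CoPH (N16LettersEnd N16PinnedLooseCmap N16PinnedLooseAx N16HolderAtReadingCmap N16HolderAtReadingAx
  eraseNE3Cmap)
open Summit.QuantumFields.YangMills.BalabanUVNodes.N16Stage3OfFamilyMat (stage3OfFamilyMat)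
open Summit.QuantumFields.YangMills.BalabanUVNodes.N16EntrySqueezeJunctionReadingFree (exists_letters_n16HolderAt_looseLayer_squeezeJunction_of_entry_reg910Slot
  exists_letters_n16HolderAt_looseLayer_of_n05UniformP_reg910Slot n16HolderAtReadingCmap_of_looseLayer)
open YMDAG.N14.TopBorn (Ne1PinnedOfRecordCmap Ne1PinnedOfRecordAx)
open Summit.QuantumFields.YangMills.BalabanUVNodes.N15.PairedFamilyGuard (KeyedLiveCmap KeyedLiveAx)

noncomputable section

variable {N : ℕ} [NeZero N] {Χ : (F : T4Family) → Stage13Params F N → ChiSlot F N} {β : ℝ}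

/-! ## §1 The reading-free tuned-witness sentence and its producers -/

variable (N) in
/-- **THE TUNED-WITNESS (∃-DIAL) SENTENCE FOR N16, READING- AND CENTRE-FREE**: SOME dial — letters `ℓ₃`, coupling letter `g`, radius letter `B` — carrying THE END's letter rows
`N16LettersEnd N g ℓ₃` and the radius MATCH row `∀ F, 0 < B F ∧ (ℓ₃ F).ε ∕ B F ≤ (ℓ₃ F).b` (the K3 skeletons' `N16RadiusMatch ℓ₃ B`, unfolded), such that N16's conjunct
`N16HolderAt · β` holds AT RR-1's { ne3ConstLayerOfRecord₁₁ F N (ℓ₃ F) with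
        dom := {V | V ∈ ne3DomOfRecord₁₁ F N 0 0 ∧ V ∈ sfClass 4 F.L (ne3NperOfRecord₁₁ F 0 0) ((ℓ₃ F).ε / B F) 0} } OBJECT OF RECORD (the constant layer of record read by `ℓ₃ F`, data CUT at radius `(ℓ₃ F).ε ∕ B F`) for EVERY family.  Module 60 §4's
`WitnessDialN16 β` quantified over CoPH readings instead; this sentence feeds every reading tower (module 62 §2).  Defined for the record; inhabited below only from the
DISPLAYED in-edges. [folklore] -/
@[folklore]
def WitnessDialN16Free (β : ℝ) : Prop :=
  ∃ (ℓ₃ : T4Family → NE3Letters₁₁) (g B : T4Family → ℝ), N16LettersEnd N g ℓ₃ ∧ (∀ F : T4Family, 0 < B F ∧ (ℓ₃ F).ε / B F ≤ (ℓ₃ F).b) ∧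
    ∀ F : T4Family, N16HolderAt (ne3OfRecord₁₁ F { ne3ConstLayerOfRecord₁₁ F N (ℓ₃ F) with
        dom := {V | V ∈ ne3DomOfRecord₁₁ F N 0 0 ∧ V ∈ sfClass 4 F.L (ne3NperOfRecord₁₁ F 0 0) ((ℓ₃ F).ε / B F) 0} }) β

/-- **★★ THE SENTENCE FROM NODE N16's CHAIN-ENTRY OBJECT AND THE SLOT KEY** (`β ≤ 1`; module 62 §1 projected: `g := gradConst 4 ∘ c'`, conjuncts 1, 2, 5).
[cite: Balaban1985Variational, Thm 1 (9)–(10) p.279] [folklore] -/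
theorem witnessDialN16Free_of_entry_reg910Slot (hβ1 : β ≤ 1)
    (hE : ∀ F : T4Family, ∃ B Bh c₁' : ℝ, 0 < B ∧ 0 < c₁' ∧ 16 * (B * c₁') ≤ 1 ∧
      ∀ k, 1 ≤ k → Thm4TorusAt F.L k (((ne3NperOfRecord₁₁ F 0 0 * F.L ^ k : ℕ) : ℤ)) (((F.L : ℝ) ^ k)⁻¹) c₁' (unitaryUnits (Matrix (Fin N) (Fin N) ℂ))
        (fun _ => True) (Restr129 F.L k (torusLam k))
        (fun (α₀ α₁ : ℝ) (U₀ U' : Site 4 → Fin 4 → (Matrix (Fin N) (Fin N) ℂ)ˣ) (u : Site 4 → (Matrix (Fin N) (Fin N) ℂ)ˣ) =>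
          ∃ A : Site 4 → Fin 4 → Matrix (Fin N) (Fin N) ℂ,
            (∀ x μ, IsSelfAdjoint (A x μ)) ∧ (∀ (x : Site 4) (κ μ : Fin 4), A (x + (((ne3NperOfRecord₁₁ F 0 0 * F.L ^ k : ℕ) : ℤ)) • e κ) μ = A x μ) ∧
            mgauge U₀ u (cfgExp (((F.L : ℝ) ^ k)⁻¹) A) = U' ∧
            (∀ x μ, ‖A x μ‖ ≤ B * (α₀ + α₁)) ∧
            (∀ (μ : Fin 4) (x : Site 4) (κ : Fin 4), ‖covDerivFwd (((F.L : ℝ) ^ k)⁻¹) U₀ μ (fun z => A z κ) x‖ ≤ B * (α₀ + α₁)) ∧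
            IsLandau138 F.L k (((F.L : ℝ) ^ k)⁻¹) Set.univ (torusLam k) U₀ A ∧
            (∀ (μ : Fin 4) (y : Site 4) (κ : Fin 4),
              ‖Ad (U₀ y μ) (covDerivFwd (((F.L : ℝ) ^ k)⁻¹) U₀ μ (fun z => A z κ) (y + e μ)) - covDerivFwd (((F.L : ℝ) ^ k)⁻¹) U₀ μ (fun z => A z κ) y‖
                ≤ Bh * (α₀ + α₁) * (((F.L : ℝ)⁻¹) ^ k) ^ β) ∧
            (∀ (x : Site 4) (κ : Fin 4), ‖covLap (((F.L : ℝ) ^ k)⁻¹) U₀ (fun z => A z κ) x‖ ≤ B * (α₀ + α₁))))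
    {G : T4Family → (Site 4 → Fin 4 → (MatA N)ˣ) → Site 4 → ℕ → ℝ → ℝ → ℝ → Prop} (hGm : ∀ F, RadiiMono 4 (G F))
    (hG : ∀ (F : T4Family) (U : Site 4 → Fin 4 → (MatA N)ˣ) (x : Site 4) (K : ℕ) (α₀ α₁ α₂ : ℝ), 2 ≤ K → G F U x K α₀ α₁ α₂ →
      ∃ (u : Site 4 → (MatA N)ˣ) (a : Site 4 → Fin 4 → MatA N),
        (∀ z, u z ∈ unitaryUnits (MatA N)) ∧
        (∀ (y : Site 4) (τ : Fin 4), l1 (y - x) ≤ 2 → ((gaugeAct u U y τ : (MatA N)ˣ) : MatA N) = exp (a y τ)) ∧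
        (∀ (y : Site 4) (τ : Fin 4), l1 (y - x) ≤ 2 → ‖a y τ‖ ≤ α₀) ∧
        (∀ (y : Site 4) (τ i : Fin 4), l1 (y - x) ≤ 1 → ‖fd i (fun z => a z τ) y‖ ≤ α₁) ∧
        (∀ (τ i l : Fin 4), ‖fd i (fd l (fun z => a z τ)) x‖ ≤ α₂))
    (C : T4Family → B11Thm1.Consts)
    (hR : ∀ (F : T4Family) (k : ℕ) (ε₁ : ℝ), 0 < ε₁ → ε₁ ≤ (C F).a₁ → ∀ (V U : Site 4 → Fin 4 → (MatA N)ˣ), V ∈ sfClass 4 F.L (ne3NperOfRecord₁₁ F 0 0) ε₁ 0 →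
      IsMinimiser 4 (sfClass 4 F.L (ne3NperOfRecord₁₁ F 0 0) ((C F).B₃ * ε₁)) F.L (ne3NperOfRecord₁₁ F 0 0) (k + 1) V U →
        ∀ x : Site 4, Regularity (torusVP 4 F.L (ne3NperOfRecord₁₁ F 0 0) (G F) (k + 1)) (C F).B₃ (C F).B₄ ε₁ U (x, F.L ^ (k + 1) - 1 + F.L ^ (k + 1) + 2)) :
    WitnessDialN16Free N β := by
  obtain ⟨ℓ₃, B, c', hend, hmatch, -, -, hrow, -⟩ := exists_letters_n16HolderAt_looseLayer_squeezeJunction_of_entry_reg910Slot (N := N) hβ1 hE hGm hG C hR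
  exact ⟨ℓ₃, fun F => gradConst 4 (c' F), B, hend, hmatch, hrow⟩

/-- **★★ THE SENTENCE FROM NODE N05's Σ-OBJECT AND THE SLOT KEY** (`0 ≤ β ≤ 1`; module 62 §3 BY NAME). [cite: Balaban1985RegularSpaces, Thm 4 p.88, Prop. 3 p.87] [folklore] -/
theorem witnessDialN16Free_of_n05UniformP_reg910Slot (hβ0 : 0 ≤ β) (hβ1 : β ≤ 1)
    (hN05 : ∀ F : T4Family, letI : CStarAlgebra (Matrix (Fin N) (Fin N) ℂ) := B10Eq29TubeLine.cstarAlgebraMatrix N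
      ∃ (Mκ Rκ : ℕ) (len : Site 4 → ℝ), (∀ v : Site 4, 0 < len v → 1 ≤ len v) ∧ (∀ μ : Fin 4, len (e μ) = 1) ∧
      ∃ (inp : B8.B9Inputs) (B₀β B₈ c₄ c₃ : ℝ), inp.B₀ ≤ B₈ ∧ 0 < c₄ ∧ 0 < c₃ ∧
        ∀ (ν : {k : ℕ // 1 ≤ k}) (a : IdxB8SubDPerκ (stage3OfFamilyMat F N) (ne3NperOfRecord₁₁ F 0 0 * F.L ^ ν.1) Mκ Rκ),
          B8.Thm4Body c₄ (5 * ((4 : ℕ) : ℝ) * F.L * B₈)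
            (fun _ : Unit => (zdGF3HP₂Per (Matrix (Fin N) (Fin N) ℂ) F.L β len a.toZdIdx (ne3NperOfRecord₁₁ F 0 0 * F.L ^ ν.1)).toGFData) ∧
          B8.Prop3Body c₃ 4 (F.L : ℝ) (2097152 * (((4 : ℕ) : ℝ) + 1) ^ 2 * (F.L : ℝ) ^ 2) inp B₀β
            (fun _ : Unit => (zdGF3HP₂Per (Matrix (Fin N) (Fin N) ℂ) F.L β len a.toZdIdx (ne3NperOfRecord₁₁ F 0 0 * F.L ^ ν.1)).toGFData2))
    {G : T4Family → (Site 4 → Fin 4 → (MatA N)ˣ) → Site 4 → ℕ → ℝ → ℝ → ℝ → Prop} (hGm : ∀ F, RadiiMono 4 (G F))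
    (hG : ∀ (F : T4Family) (U : Site 4 → Fin 4 → (MatA N)ˣ) (x : Site 4) (K : ℕ) (α₀ α₁ α₂ : ℝ), 2 ≤ K → G F U x K α₀ α₁ α₂ →
      ∃ (u : Site 4 → (MatA N)ˣ) (a : Site 4 → Fin 4 → MatA N),
        (∀ z, u z ∈ unitaryUnits (MatA N)) ∧
        (∀ (y : Site 4) (τ : Fin 4), l1 (y - x) ≤ 2 → ((gaugeAct u U y τ : (MatA N)ˣ) : MatA N) = exp (a y τ)) ∧
        (∀ (y : Site 4) (τ : Fin 4), l1 (y - x) ≤ 2 → ‖a y τ‖ ≤ α₀) ∧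
        (∀ (y : Site 4) (τ i : Fin 4), l1 (y - x) ≤ 1 → ‖fd i (fun z => a z τ) y‖ ≤ α₁) ∧
        (∀ (τ i l : Fin 4), ‖fd i (fd l (fun z => a z τ)) x‖ ≤ α₂))
    (C : T4Family → B11Thm1.Consts)
    (hR : ∀ (F : T4Family) (k : ℕ) (ε₁ : ℝ), 0 < ε₁ → ε₁ ≤ (C F).a₁ → ∀ (V U : Site 4 → Fin 4 → (MatA N)ˣ), V ∈ sfClass 4 F.L (ne3NperOfRecord₁₁ F 0 0) ε₁ 0 →
      IsMinimiser 4 (sfClass 4 F.L (ne3NperOfRecord₁₁ F 0 0) ((C F).B₃ * ε₁)) F.L (ne3NperOfRecord₁₁ F 0 0) (k + 1) V U →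
        ∀ x : Site 4, Regularity (torusVP 4 F.L (ne3NperOfRecord₁₁ F 0 0) (G F) (k + 1)) (C F).B₃ (C F).B₄ ε₁ U (x, F.L ^ (k + 1) - 1 + F.L ^ (k + 1) + 2)) :
    WitnessDialN16Free N β :=
  exists_letters_n16HolderAt_looseLayer_of_n05UniformP_reg910Slot hβ0 hβ1 hN05 hGm hG C hR

/-! ## §2 Re-pinning the NE3 layer of a centre-map-generic reading at a dial -/

/-- **THE RE-PINNED READING** (module 60's `repin` over `RateReading₁₃CoPHCmap N Χ`): `𝔯` with its NE3 layer RE-PINNED { ne3ConstLayerOfRecord₁₁ F N (ℓ₃ F) with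
        dom := {V | V ∈ ne3DomOfRecord₁₁ F N 0 0 ∧ V ∈ sfClass 4 F.L (ne3NperOfRecord₁₁ F 0 0) ((ℓ₃ F).ε / B F) 0} } at the dial `(ℓ₃, B)` at every run length — node U3's
objects, N15's layer and N14's tower are `𝔯`'s, untouched (R12's `eraseNE3Cmap` pattern). [folklore] -/
@[folklore]
def repinCmap (𝔯 : RateReading₁₃CoPHCmap N Χ) (ℓ₃ : T4Family → NE3Letters₁₁) (B : T4Family → ℝ) : RateReading₁₃CoPHCmap N Χ :=
  ⟨fun F θ hP g₀ os => { 𝔯.lit F θ hP g₀ os with ne3 := fun _ => { ne3ConstLayerOfRecord₁₁ F N (ℓ₃ F) with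
        dom := {V | V ∈ ne3DomOfRecord₁₁ F N 0 0 ∧ V ∈ sfClass 4 F.L (ne3NperOfRecord₁₁ F 0 0) ((ℓ₃ F).ε / B F) 0} } }, 𝔯.ne1⟩

/-- The same at THE RE-CENTRED READING (instance `Χ := chiβOfRecord₁₃Ax`). [folklore] -/
abbrev repinAx (𝔯 : RateReading₁₃CoPHAx N) (ℓ₃ : T4Family → NE3Letters₁₁) (B : T4Family → ℝ) : RateReading₁₃CoPHAx N := repinCmap 𝔯 ℓ₃ B

/-- **THE RE-PINNED READING IS PINNED { ne3ConstLayerOfRecord₁₁ F N (ℓ₃ F) with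
        dom := {V | V ∈ ne3DomOfRecord₁₁ F N 0 0 ∧ V ∈ sfClass 4 F.L (ne3NperOfRecord₁₁ F 0 0) ((ℓ₃ F).ε / B F) 0} } AT ITS DIAL** (`rfl`) — the skeleton's conjunct `N16PinnedLooseAx 𝔯' ℓ₃ B` at `𝔯' := repinCmap 𝔯 ℓ₃ B`. [folklore] -/
theorem n16PinnedLooseCmap_repin (𝔯 : RateReading₁₃CoPHCmap N Χ) (ℓ₃ : T4Family → NE3Letters₁₁) (B : T4Family → ℝ) :
    N16PinnedLooseCmap (repinCmap 𝔯 ℓ₃ B) ℓ₃ B :=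
  fun _ _ _ _ _ _ => rfl

section Faces

variable (𝔯 : RateReading₁₃CoPHCmap N Χ) (ℓ₃ ℓ₃' : T4Family → NE3Letters₁₁) (B B' : T4Family → ℝ) {F : T4Family} (θ : Stage13HParams F N)
  (hP : θ.Provisos₁₃CoPHChi F N (Χ F θ.toStage13Params)) (g₀ : ℕ → ℝ) (os : List (ULoop F)) (k : ℕ)

/-- Face (`rfl`): N14's tower is `𝔯`'s. [folklore] -/
theorem repinCmap_ne1 : (repinCmap 𝔯 ℓ₃ B).ne1 F θ hP g₀ os = 𝔯.ne1 F θ hP g₀ os := rfl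
/-- Face (`rfl`): node U3's objects are `𝔯`'s. [folklore] -/
theorem repinCmap_lit_u3 : ((repinCmap 𝔯 ℓ₃ B).lit F θ hP g₀ os).u3 = (𝔯.lit F θ hP g₀ os).u3 := rfl
/-- Face (`rfl`): N15's layer is `𝔯`'s. [folklore] -/
theorem repinCmap_lit_ne2 : ((repinCmap 𝔯 ℓ₃ B).lit F θ hP g₀ os).ne2 k = (𝔯.lit F θ hP g₀ os).ne2 k := rfl
/-- Face (`rfl`): the NE3 layer is RR-1's loose object at the dial, at every run length. [folklore] -/
theorem repinCmap_lit_ne3 : ((repinCmap 𝔯 ℓ₃ B).lit F θ hP g₀ os).ne3 k = { ne3ConstLayerOfRecord₁₁ F N (ℓ₃ F) with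
        dom := {V | V ∈ ne3DomOfRecord₁₁ F N 0 0 ∧ V ∈ sfClass 4 F.L (ne3NperOfRecord₁₁ F 0 0) ((ℓ₃ F).ε / B F) 0} } := rfl
/-- Face (`rfl`) at the bundle of record: the N14 component. [folklore] -/
theorem rateCarriersCmap_repin_ne1 :
    (rateCarriersOfRecord₁₃CoPHCmap (repinCmap 𝔯 ℓ₃ B) F θ hP g₀ os k).ne1 = (rateCarriersOfRecord₁₃CoPHCmap 𝔯 F θ hP g₀ os k).ne1 := rfl
/-- Face (`rfl`) at the bundle of record: the N15 component. [folklore] -/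
theorem rateCarriersCmap_repin_ne2 :
    (rateCarriersOfRecord₁₃CoPHCmap (repinCmap 𝔯 ℓ₃ B) F θ hP g₀ os k).ne2 = (rateCarriersOfRecord₁₃CoPHCmap 𝔯 F θ hP g₀ os k).ne2 := rfl
/-- Face (`rfl`) at the bundle of record: node U3's component. [folklore] -/
theorem rateCarriersCmap_repin_u3 :
    (rateCarriersOfRecord₁₃CoPHCmap (repinCmap 𝔯 ℓ₃ B) F θ hP g₀ os k).u3 = (rateCarriersOfRecord₁₃CoPHCmap 𝔯 F θ hP g₀ os k).u3 := rfl
/-- Face (`rfl`) at the bundle of record: the NE3 component is RR-1's loose object of record BY NAME. [folklore] -/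
theorem rateCarriersCmap_repin_ne3 :
    (rateCarriersOfRecord₁₃CoPHCmap (repinCmap 𝔯 ℓ₃ B) F θ hP g₀ os k).ne3 = ne3OfRecord₁₁ F { ne3ConstLayerOfRecord₁₁ F N (ℓ₃ F) with
        dom := {V | V ∈ ne3DomOfRecord₁₁ F N 0 0 ∧ V ∈ sfClass 4 F.L (ne3NperOfRecord₁₁ F 0 0) ((ℓ₃ F).ε / B F) 0} } := rfl
/-- Re-pinning twice keeps the last dial (`rfl`). [folklore] -/
theorem repinCmap_repinCmap : repinCmap (repinCmap 𝔯 ℓ₃ B) ℓ₃' B' = repinCmap 𝔯 ℓ₃' B' := rfl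
/-- Off the NE3 layer the re-pinned reading IS `𝔯` (`rfl`): both have the same NE3-erased reading (R12's `eraseNE3Cmap`). [folklore] -/
theorem eraseNE3Cmap_repinCmap : eraseNE3Cmap (repinCmap 𝔯 ℓ₃ B) = eraseNE3Cmap 𝔯 := rfl

end Faces

/-! ## §3 ★ Node N16's stub-1 share at a centre-map-generic reading, relative to any guard that does not read the NE3 layer -/

/-- **THE WITNESSED DIAL AT A READING**: from `WitnessDialN16Free N β`, for ANY reading `𝔯 : RateReading₁₃CoPHCmap N Χ`, a dial `(ℓ₃, g, B)` such that the re-pinned reading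
`repinCmap 𝔯 ℓ₃ B` is pinned loose there, the letters carry THE END's rows and the MATCH row, and the re-pinned reading satisfies N16's conjunct at every Stage-13 tuple with
χ-provisos and every run length (module 62 §2 ∘ §2's pin face). [bookkeeping] -/
theorem exists_pin_n16HolderAtReadingCmap_of_witnessFree (h : WitnessDialN16Free N β) (𝔯 : RateReading₁₃CoPHCmap N Χ) :
    ∃ (ℓ₃ : T4Family → NE3Letters₁₁) (g B : T4Family → ℝ), N16PinnedLooseCmap (repinCmap 𝔯 ℓ₃ B) ℓ₃ B ∧ N16LettersEnd N g ℓ₃ ∧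
      (∀ F : T4Family, 0 < B F ∧ (ℓ₃ F).ε / B F ≤ (ℓ₃ F).b) ∧ N16HolderAtReadingCmap (repinCmap 𝔯 ℓ₃ B) β := by
  obtain ⟨ℓ₃, g, B, hend, hmatch, hrow⟩ := h
  exact ⟨ℓ₃, g, B, n16PinnedLooseCmap_repin 𝔯 ℓ₃ B, hend, hmatch, n16HolderAtReadingCmap_of_looseLayer hrow _ (n16PinnedLooseCmap_repin 𝔯 ℓ₃ B)⟩

/-- **★ NODE N16's STUB-1 SHARE, GUARD-GENERIC** — for ANY predicate `G` on readings closed under re-pinning the NE3 layer (`hG`; the K3ᴬ v8 skeleton's `fun 𝔯 => GuardedReading 𝔯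
ksel ℓ` is, by `fun _ _ _ h => h` — §4), ANY reading `𝔯` with `G 𝔯`, and `WitnessDialN16Free N β`: a reading `𝔯'` (namely `repinCmap 𝔯 ℓ₃ B`) and a dial `(ℓ₃, g, B)` with
`G 𝔯'` ∧ the pin `N16PinnedLooseCmap 𝔯' ℓ₃ B` ∧ THE END's rows `N16LettersEnd N g ℓ₃` ∧ the MATCH row (= the skeleton's `N16RadiusMatch ℓ₃ B` unfolded) ∧ N16's conjunct of the
rates row `N16HolderAt (rateCarriersOfRecord₁₃CoPHCmap 𝔯' F θ hP g₀ os k).ne3 β` at EVERY tuple and run length (so at `k := ksel F θ hP g₀ os`, i.e. at `rrOfRecord 𝔯' ksel`) —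
stub 1's `GuardedReadingN16 𝔯' ksel ℓ ℓ₃ g B` is `⟨G-part, pin, END, MATCH⟩` and N16's conjunct of `PHolderD4` is the last row.  The other conjuncts of `KeyedRatesHolderD4V` are
the other lanes'. [bookkeeping] -/
theorem exists_guarded_pin_n16HolderAt_rateCarriersCmap_of_witnessFree {G : RateReading₁₃CoPHCmap N Χ → Prop}
    (hG : ∀ (𝔯 : RateReading₁₃CoPHCmap N Χ) (ℓ₃ : T4Family → NE3Letters₁₁) (B : T4Family → ℝ), G 𝔯 → G (repinCmap 𝔯 ℓ₃ B))
    (h : WitnessDialN16Free N β) {𝔯 : RateReading₁₃CoPHCmap N Χ} (h𝔯 : G 𝔯) :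
    ∃ (𝔯' : RateReading₁₃CoPHCmap N Χ) (ℓ₃ : T4Family → NE3Letters₁₁) (g B : T4Family → ℝ), G 𝔯' ∧ N16PinnedLooseCmap 𝔯' ℓ₃ B ∧ N16LettersEnd N g ℓ₃ ∧
      (∀ F : T4Family, 0 < B F ∧ (ℓ₃ F).ε / B F ≤ (ℓ₃ F).b) ∧
      ∀ (F : T4Family) (θ : Stage13HParams F N) (hP : θ.Provisos₁₃CoPHChi F N (Χ F θ.toStage13Params)) (g₀ : ℕ → ℝ) (os : List (ULoop F)) (k : ℕ),
        N16HolderAt (rateCarriersOfRecord₁₃CoPHCmap 𝔯' F θ hP g₀ os k).ne3 β := by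
  obtain ⟨ℓ₃, g, B, hpin, hend, hmatch, hread⟩ := exists_pin_n16HolderAtReadingCmap_of_witnessFree h 𝔯
  exact ⟨repinCmap 𝔯 ℓ₃ B, ℓ₃, g, B, hG 𝔯 ℓ₃ B h𝔯, hpin, hend, hmatch, hread⟩

/-- **★ THE SAME AT THE RE-CENTRED (Ax) READING OF THE K3ᴬ v8 SKELETON** (`RateReading₁₃CoPHAx N`, binder `θ.Provisos₁₃CoPHAx F N`, pin `N16PinnedLooseAx`). [bookkeeping] -/
theorem exists_guarded_pin_n16HolderAt_rateCarriersAx_of_witnessFree {G : RateReading₁₃CoPHAx N → Prop}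
    (hG : ∀ (𝔯 : RateReading₁₃CoPHAx N) (ℓ₃ : T4Family → NE3Letters₁₁) (B : T4Family → ℝ), G 𝔯 → G (repinAx 𝔯 ℓ₃ B))
    (h : WitnessDialN16Free N β) {𝔯 : RateReading₁₃CoPHAx N} (h𝔯 : G 𝔯) :
    ∃ (𝔯' : RateReading₁₃CoPHAx N) (ℓ₃ : T4Family → NE3Letters₁₁) (g B : T4Family → ℝ), G 𝔯' ∧ N16PinnedLooseAx 𝔯' ℓ₃ B ∧ N16LettersEnd N g ℓ₃ ∧
      (∀ F : T4Family, 0 < B F ∧ (ℓ₃ F).ε / B F ≤ (ℓ₃ F).b) ∧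
      ∀ (F : T4Family) (θ : Stage13HParams F N) (hP : θ.Provisos₁₃CoPHAx F N) (g₀ : ℕ → ℝ) (os : List (ULoop F)) (k : ℕ),
        N16HolderAt (rateCarriersOfRecord₁₃CoPHCmap 𝔯' F θ hP g₀ os k).ne3 β :=
  exists_guarded_pin_n16HolderAt_rateCarriersCmap_of_witnessFree hG h h𝔯

/-- **★★ END-TO-END AT THE Ax READING, FROM NODE N16's CHAIN-ENTRY OBJECT AND THE SLOT KEY** (`β ≤ 1`): §1's producer ∘ §3 — the stub-1 closer's ONE N16 input given its
guarded reading `𝔯` and the displayed in-edges `hE` (node N05∕N16 chain entry) + `Gs hGm hG C hR` (node N07's slot key). [cite: Balaban1985Variational, Thm 1 (9)–(10) p.279] [folklore] -/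
theorem exists_guarded_pin_n16HolderAt_rateCarriersAx_of_entry_reg910Slot (hβ1 : β ≤ 1)
    (hE : ∀ F : T4Family, ∃ B Bh c₁' : ℝ, 0 < B ∧ 0 < c₁' ∧ 16 * (B * c₁') ≤ 1 ∧
      ∀ k, 1 ≤ k → Thm4TorusAt F.L k (((ne3NperOfRecord₁₁ F 0 0 * F.L ^ k : ℕ) : ℤ)) (((F.L : ℝ) ^ k)⁻¹) c₁' (unitaryUnits (Matrix (Fin N) (Fin N) ℂ))
        (fun _ => True) (Restr129 F.L k (torusLam k))
        (fun (α₀ α₁ : ℝ) (U₀ U' : Site 4 → Fin 4 → (Matrix (Fin N) (Fin N) ℂ)ˣ) (u : Site 4 → (Matrix (Fin N) (Fin N) ℂ)ˣ) =>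
          ∃ A : Site 4 → Fin 4 → Matrix (Fin N) (Fin N) ℂ,
            (∀ x μ, IsSelfAdjoint (A x μ)) ∧ (∀ (x : Site 4) (κ μ : Fin 4), A (x + (((ne3NperOfRecord₁₁ F 0 0 * F.L ^ k : ℕ) : ℤ)) • e κ) μ = A x μ) ∧
            mgauge U₀ u (cfgExp (((F.L : ℝ) ^ k)⁻¹) A) = U' ∧
            (∀ x μ, ‖A x μ‖ ≤ B * (α₀ + α₁)) ∧
            (∀ (μ : Fin 4) (x : Site 4) (κ : Fin 4), ‖covDerivFwd (((F.L : ℝ) ^ k)⁻¹) U₀ μ (fun z => A z κ) x‖ ≤ B * (α₀ + α₁)) ∧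
            IsLandau138 F.L k (((F.L : ℝ) ^ k)⁻¹) Set.univ (torusLam k) U₀ A ∧
            (∀ (μ : Fin 4) (y : Site 4) (κ : Fin 4),
              ‖Ad (U₀ y μ) (covDerivFwd (((F.L : ℝ) ^ k)⁻¹) U₀ μ (fun z => A z κ) (y + e μ)) - covDerivFwd (((F.L : ℝ) ^ k)⁻¹) U₀ μ (fun z => A z κ) y‖
                ≤ Bh * (α₀ + α₁) * (((F.L : ℝ)⁻¹) ^ k) ^ β) ∧
            (∀ (x : Site 4) (κ : Fin 4), ‖covLap (((F.L : ℝ) ^ k)⁻¹) U₀ (fun z => A z κ) x‖ ≤ B * (α₀ + α₁))))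
    {G : T4Family → (Site 4 → Fin 4 → (MatA N)ˣ) → Site 4 → ℕ → ℝ → ℝ → ℝ → Prop} (hGm : ∀ F, RadiiMono 4 (G F))
    (hG : ∀ (F : T4Family) (U : Site 4 → Fin 4 → (MatA N)ˣ) (x : Site 4) (K : ℕ) (α₀ α₁ α₂ : ℝ), 2 ≤ K → G F U x K α₀ α₁ α₂ →
      ∃ (u : Site 4 → (MatA N)ˣ) (a : Site 4 → Fin 4 → MatA N),
        (∀ z, u z ∈ unitaryUnits (MatA N)) ∧
        (∀ (y : Site 4) (τ : Fin 4), l1 (y - x) ≤ 2 → ((gaugeAct u U y τ : (MatA N)ˣ) : MatA N) = exp (a y τ)) ∧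
        (∀ (y : Site 4) (τ : Fin 4), l1 (y - x) ≤ 2 → ‖a y τ‖ ≤ α₀) ∧
        (∀ (y : Site 4) (τ i : Fin 4), l1 (y - x) ≤ 1 → ‖fd i (fun z => a z τ) y‖ ≤ α₁) ∧
        (∀ (τ i l : Fin 4), ‖fd i (fd l (fun z => a z τ)) x‖ ≤ α₂))
    (C : T4Family → B11Thm1.Consts)
    (hR : ∀ (F : T4Family) (k : ℕ) (ε₁ : ℝ), 0 < ε₁ → ε₁ ≤ (C F).a₁ → ∀ (V U : Site 4 → Fin 4 → (MatA N)ˣ), V ∈ sfClass 4 F.L (ne3NperOfRecord₁₁ F 0 0) ε₁ 0 →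
      IsMinimiser 4 (sfClass 4 F.L (ne3NperOfRecord₁₁ F 0 0) ((C F).B₃ * ε₁)) F.L (ne3NperOfRecord₁₁ F 0 0) (k + 1) V U →
        ∀ x : Site 4, Regularity (torusVP 4 F.L (ne3NperOfRecord₁₁ F 0 0) (G F) (k + 1)) (C F).B₃ (C F).B₄ ε₁ U (x, F.L ^ (k + 1) - 1 + F.L ^ (k + 1) + 2))
    {Gd : RateReading₁₃CoPHAx N → Prop} (hGd : ∀ (𝔯 : RateReading₁₃CoPHAx N) (ℓ₃ : T4Family → NE3Letters₁₁) (B : T4Family → ℝ), Gd 𝔯 → Gd (repinAx 𝔯 ℓ₃ B))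
    {𝔯 : RateReading₁₃CoPHAx N} (h𝔯 : Gd 𝔯) :
    ∃ (𝔯' : RateReading₁₃CoPHAx N) (ℓ₃ : T4Family → NE3Letters₁₁) (g B : T4Family → ℝ), Gd 𝔯' ∧ N16PinnedLooseAx 𝔯' ℓ₃ B ∧ N16LettersEnd N g ℓ₃ ∧
      (∀ F : T4Family, 0 < B F ∧ (ℓ₃ F).ε / B F ≤ (ℓ₃ F).b) ∧
      ∀ (F : T4Family) (θ : Stage13HParams F N) (hP : θ.Provisos₁₃CoPHAx F N) (g₀ : ℕ → ℝ) (os : List (ULoop F)) (k : ℕ),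
        N16HolderAt (rateCarriersOfRecord₁₃CoPHCmap 𝔯' F θ hP g₀ os k).ne3 β :=
  exists_guarded_pin_n16HolderAt_rateCarriersAx_of_witnessFree hGd (witnessDialN16Free_of_entry_reg910Slot hβ1 hE hGm hG C hR) h𝔯

/-- **★★ END-TO-END AT THE Ax READING, FROM NODE N05's Σ-OBJECT AND THE SLOT KEY** (`0 ≤ β ≤ 1`). [cite: Balaban1985RegularSpaces, Thm 4 p.88, Prop. 3 p.87] [folklore] -/
theorem exists_guarded_pin_n16HolderAt_rateCarriersAx_of_n05UniformP_reg910Slot (hβ0 : 0 ≤ β) (hβ1 : β ≤ 1)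
    (hN05 : ∀ F : T4Family, letI : CStarAlgebra (Matrix (Fin N) (Fin N) ℂ) := B10Eq29TubeLine.cstarAlgebraMatrix N
      ∃ (Mκ Rκ : ℕ) (len : Site 4 → ℝ), (∀ v : Site 4, 0 < len v → 1 ≤ len v) ∧ (∀ μ : Fin 4, len (e μ) = 1) ∧
      ∃ (inp : B8.B9Inputs) (B₀β B₈ c₄ c₃ : ℝ), inp.B₀ ≤ B₈ ∧ 0 < c₄ ∧ 0 < c₃ ∧
        ∀ (ν : {k : ℕ // 1 ≤ k}) (a : IdxB8SubDPerκ (stage3OfFamilyMat F N) (ne3NperOfRecord₁₁ F 0 0 * F.L ^ ν.1) Mκ Rκ),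
          B8.Thm4Body c₄ (5 * ((4 : ℕ) : ℝ) * F.L * B₈)
            (fun _ : Unit => (zdGF3HP₂Per (Matrix (Fin N) (Fin N) ℂ) F.L β len a.toZdIdx (ne3NperOfRecord₁₁ F 0 0 * F.L ^ ν.1)).toGFData) ∧
          B8.Prop3Body c₃ 4 (F.L : ℝ) (2097152 * (((4 : ℕ) : ℝ) + 1) ^ 2 * (F.L : ℝ) ^ 2) inp B₀β
            (fun _ : Unit => (zdGF3HP₂Per (Matrix (Fin N) (Fin N) ℂ) F.L β len a.toZdIdx (ne3NperOfRecord₁₁ F 0 0 * F.L ^ ν.1)).toGFData2))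
    {G : T4Family → (Site 4 → Fin 4 → (MatA N)ˣ) → Site 4 → ℕ → ℝ → ℝ → ℝ → Prop} (hGm : ∀ F, RadiiMono 4 (G F))
    (hG : ∀ (F : T4Family) (U : Site 4 → Fin 4 → (MatA N)ˣ) (x : Site 4) (K : ℕ) (α₀ α₁ α₂ : ℝ), 2 ≤ K → G F U x K α₀ α₁ α₂ →
      ∃ (u : Site 4 → (MatA N)ˣ) (a : Site 4 → Fin 4 → MatA N),
        (∀ z, u z ∈ unitaryUnits (MatA N)) ∧
        (∀ (y : Site 4) (τ : Fin 4), l1 (y - x) ≤ 2 → ((gaugeAct u U y τ : (MatA N)ˣ) : MatA N) = exp (a y τ)) ∧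
        (∀ (y : Site 4) (τ : Fin 4), l1 (y - x) ≤ 2 → ‖a y τ‖ ≤ α₀) ∧
        (∀ (y : Site 4) (τ i : Fin 4), l1 (y - x) ≤ 1 → ‖fd i (fun z => a z τ) y‖ ≤ α₁) ∧
        (∀ (τ i l : Fin 4), ‖fd i (fd l (fun z => a z τ)) x‖ ≤ α₂))
    (C : T4Family → B11Thm1.Consts)
    (hR : ∀ (F : T4Family) (k : ℕ) (ε₁ : ℝ), 0 < ε₁ → ε₁ ≤ (C F).a₁ → ∀ (V U : Site 4 → Fin 4 → (MatA N)ˣ), V ∈ sfClass 4 F.L (ne3NperOfRecord₁₁ F 0 0) ε₁ 0 →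
      IsMinimiser 4 (sfClass 4 F.L (ne3NperOfRecord₁₁ F 0 0) ((C F).B₃ * ε₁)) F.L (ne3NperOfRecord₁₁ F 0 0) (k + 1) V U →
        ∀ x : Site 4, Regularity (torusVP 4 F.L (ne3NperOfRecord₁₁ F 0 0) (G F) (k + 1)) (C F).B₃ (C F).B₄ ε₁ U (x, F.L ^ (k + 1) - 1 + F.L ^ (k + 1) + 2))
    {Gd : RateReading₁₃CoPHAx N → Prop} (hGd : ∀ (𝔯 : RateReading₁₃CoPHAx N) (ℓ₃ : T4Family → NE3Letters₁₁) (B : T4Family → ℝ), Gd 𝔯 → Gd (repinAx 𝔯 ℓ₃ B))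
    {𝔯 : RateReading₁₃CoPHAx N} (h𝔯 : Gd 𝔯) :
    ∃ (𝔯' : RateReading₁₃CoPHAx N) (ℓ₃ : T4Family → NE3Letters₁₁) (g B : T4Family → ℝ), Gd 𝔯' ∧ N16PinnedLooseAx 𝔯' ℓ₃ B ∧ N16LettersEnd N g ℓ₃ ∧
      (∀ F : T4Family, 0 < B F ∧ (ℓ₃ F).ε / B F ≤ (ℓ₃ F).b) ∧
      ∀ (F : T4Family) (θ : Stage13HParams F N) (hP : θ.Provisos₁₃CoPHAx F N) (g₀ : ℕ → ℝ) (os : List (ULoop F)) (k : ℕ),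
        N16HolderAt (rateCarriersOfRecord₁₃CoPHCmap 𝔯' F θ hP g₀ os k).ne3 β :=
  exists_guarded_pin_n16HolderAt_rateCarriersAx_of_witnessFree hGd (witnessDialN16Free_of_n05UniformP_reg910Slot hβ0 hβ1 hN05 hGm hG C hR) h𝔯

/-! ## §4 The tree conjuncts of the v8 guard do not read the NE3 layer (`h ↦ h`) -/

section Guards

variable (𝔯 : RateReading₁₃CoPHCmap N Χ) (ℓ₃ : T4Family → NE3Letters₁₁) (B : T4Family → ℝ)

/-- R9's N14 pin `Ne1PinnedOfRecordCmap` (the v8 guard's first conjunct, `Ne1PinnedOfRecordAx` at the Ax instance) transfers to the re-pinned reading by `h ↦ h`. [bookkeeping] -/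
theorem ne1PinnedOfRecordCmap_repinCmap (h : Ne1PinnedOfRecordCmap 𝔯) : Ne1PinnedOfRecordCmap (repinCmap 𝔯 ℓ₃ B) := h

variable (Χ) in
/-- R11's keyed N15 liveness `KeyedLiveCmap` of the bundle of record at any run-length selector `ksel` (the v8 guard's second conjunct `KeyedLiveAx (rrOfRecord 𝔯 ksel)`, `rrOfRecord`
unfolded) transfers to the re-pinned reading by `h ↦ h`. [bookkeeping] -/
theorem keyedLiveCmap_rateCarriersCmap_repinCmap
    (ksel : (F : T4Family) → (θ : Stage13HParams F N) → θ.Provisos₁₃CoPHChi F N (Χ F θ.toStage13Params) → (ℕ → ℝ) → List (ULoop F) → ℕ)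
    (h : KeyedLiveCmap Χ fun F θ hP g₀ os => rateCarriersOfRecord₁₃CoPHCmap 𝔯 F θ hP g₀ os (ksel F θ hP g₀ os)) :
    KeyedLiveCmap Χ fun F θ hP g₀ os => rateCarriersOfRecord₁₃CoPHCmap (repinCmap 𝔯 ℓ₃ B) F θ hP g₀ os (ksel F θ hP g₀ os) := h

/-- … and so does any pin of node U3's objects or of N15's layer stated through `(𝔯.lit …).u3` ∕ `(𝔯.lit …).ne2` (the v8 skeleton's `U3PinnedKernels` ∕ `N15PinnedSized`
shapes, written here with an arbitrary right-hand side). [bookkeeping] -/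
theorem lit_u3_ne2_pins_repinCmap {u : (F : T4Family) → Stage13HParams F N → Node00.U3Objects₁₁} {n : (F : T4Family) → ℕ → Node00.NE2Objects₁₁}
    (hu : ∀ (F : T4Family) (θ : Stage13HParams F N) (hP : θ.Provisos₁₃CoPHChi F N (Χ F θ.toStage13Params)) (g₀ : ℕ → ℝ) (os : List (ULoop F)),
      (𝔯.lit F θ hP g₀ os).u3 = u F θ)
    (hn : ∀ (F : T4Family) (θ : Stage13HParams F N) (hP : θ.Provisos₁₃CoPHChi F N (Χ F θ.toStage13Params)) (g₀ : ℕ → ℝ) (os : List (ULoop F)) (k : ℕ),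
      (𝔯.lit F θ hP g₀ os).ne2 k = n F k) :
    (∀ (F : T4Family) (θ : Stage13HParams F N) (hP : θ.Provisos₁₃CoPHChi F N (Χ F θ.toStage13Params)) (g₀ : ℕ → ℝ) (os : List (ULoop F)),
      ((repinCmap 𝔯 ℓ₃ B).lit F θ hP g₀ os).u3 = u F θ) ∧
    (∀ (F : T4Family) (θ : Stage13HParams F N) (hP : θ.Provisos₁₃CoPHChi F N (Χ F θ.toStage13Params)) (g₀ : ℕ → ℝ) (os : List (ULoop F)) (k : ℕ),
      ((repinCmap 𝔯 ℓ₃ B).lit F θ hP g₀ os).ne2 k = n F k) :=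
  ⟨hu, hn⟩

end Guards

end

end Summit.QuantumFields.YangMills.BalabanUVNodes.N16WitnessDialFaceCmap
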